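import Summits.NavierStokesRegularity.NavierStokesRegularity.Theorems.ExtremiserTransienceAnalyticGapDefs
import Mathlib.Analysis.InnerProductSpace.Calculus
import Mathlib.Analysis.Calculus.ContDiff.Bounds
import Mathlib.MeasureTheory.Measure.Lebesgue.EqHaar
import HarnessLib

/-!
# Route `ExtremiserTransience`, crux `NearExtremalTransiencePerFlow` (stmt-NavierStokesRegularity-26567), LINE g8-β «analytic gap»:
# STUB P-R `AnalyticPropagationOfSmallness → AnalyticPlateauSpread` PROVED (by name, over the texts of record)

`--supports stmt-NavierStokesRegularity-26567` (helper: LINE g8-β = crux workfile `Cruxes/NearExtremalTransiencePerFlow/Lines/analytic_gap.lean`,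
rev 3, PASS idea-crit-4 2026-08-28T21:45:37Z; not the registered skeleton of record).  Author: prover seat `ns-net-p1` (g2).

`analyticPlateauSpread_of_propagation : AnalyticPropagationOfSmallness → AnalyticPlateauSpread` (texts of record
`…Theorems.NearExtremalTransiencePerFlow.AnalyticGap.*`, p673336; in the workfile
`theorem stub_analyticPlateauSpread : AnalyticPropagationOfSmallness → AnalyticPlateauSpread := analyticPlateauSpread_of_propagation`).
THE BOOKKEEPING (Remez/propagation of smallness for the analytic function `g = M² − ‖v‖²`):
* `g` is smooth, `0 ≤ g ≤ M²`, and by Leibniz (`ContinuousLinearMap.norm_iteratedFDeriv_le_of_bilinear` for the inner product, ‖·‖ ≤ 1)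
  and the analytic budget `‖Dⁱv‖ ≤ i!ρ^{-i}Mλ^{-i}`: `‖Dʲg‖ ≤ (j+1)·j!·ρ^{-j}·M²·λ^{-j} ≤ M²·j!/(ρλ/2)ʲ ≤ M²·j!/(ρ_F·R₁λ)ʲ` with `R₁ = max R r`,
  `ρ_F = min 1 (ρ/(2R₁))`;
* on the fat near-top set `E = {x ∈ B(x₀,rλ) : ‖v‖ ≥ (1−δ)M}` (`δ ≤ 1/2`): `g ≤ 2δM²`, and `|E| ≥ c₀(rλ)³ ≥ s·|B(x₀,R₁λ)|` with
  `s = min 1 (c₀r³/(R₁³·vol B(0,1)))`;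
* the fact P-F at `(ρ_F, s)` gives `N_c, θ` with `sup_{B(x₀,R₁λ)} g ≤ N_c (⨍_E g)^θ (M²)^{1−θ} ≤ N_c (2δ)^θ M²`; with
  `δ = min (1/2) (½(η'/N_c)^{1/θ})`, `η' = min η 1`, this is `≤ η'M²`, i.e. `‖v‖² ≥ (1−η')M²` on `B(x₀,Rλ)`, whence `‖v‖ ≥ (1−η)M`.
HONEST FRAMING: an implication from a cited-but-not-yet-typed Literature fact (P-F: Vessella 1999 / Apraiz–Escauriaza–Wang–Zhang 2014 Thm 4) to
the line's P-R; nothing about Navier–Stokes regularity or blow-up is proved; no summit is proved by a line. [folklore]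
-/

noncomputable section

open scoped Topology InnerProductSpace RealInnerProductSpace ENNReal NNReal ContDiff Nat
open MeasureTheory Filter Set Metric Function
open Literature.Analysis Literature.Analysis.FluidPDE
open Summit.NavierStokesRegularity.NavierStokesRegularity.Theorems.DepletionLadder.KStar
open Summit.NavierStokesRegularity.NavierStokesRegularity.Theorems.DepletionLadder.KStar.HalfSpace
open Summit.NavierStokesRegularity.NavierStokesRegularity.Theorems.DepletionLadder.KStar.BangBang

namespace Summit.NavierStokesRegularity.NavierStokesRegularity.Theorems.NearExtremalTransiencePerFlow.AnalyticGap

-- the problem directory repeats the summit name (`NavierStokesRegularity/NavierStokesRegularity`)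
set_option linter.dupNamespace false

/-- **Leibniz for `‖v‖²` under the analytic budget**: if `‖Dⁱv‖ ≤ i!·ρ^{-i}·M·λ^{-i}` for all `i`, then
`‖Dʲ(‖v‖²)‖ ≤ (j+1)·j!·ρ^{-j}·M²·λ^{-j}`. [folklore] -/
theorem norm_iteratedFDeriv_normSq_le {ρ : ℝ} {v : E3 → E3} {M : ℝ} (hv : ContDiff ℝ (⊤ : ℕ∞) v) (hM : 0 ≤ M)
    (hρ : 0 < ρ) (hlam : 0 < lam v) (hAn : IsAnalyticReg ρ v M) (j : ℕ) (y : E3) :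
    ‖iteratedFDeriv ℝ j (fun y => ‖v y‖ ^ 2) y‖ ≤ ((j : ℝ) + 1) * ((j ! : ℝ) * ρ⁻¹ ^ j * M ^ 2 * (lam v)⁻¹ ^ j) := by
  have hfun : (fun y => ‖v y‖ ^ 2) = fun y => (innerSL ℝ (v y)) (v y) := by
    funext y; rw [innerSL_apply_apply, real_inner_self_eq_norm_sq]
  rw [hfun]
  have h := ContinuousLinearMap.norm_iteratedFDeriv_le_of_bilinear (innerSL ℝ) hv hv y (n := j) (by exact_mod_cast le_top)
  refine h.trans ?_
  have hB : ‖(innerSL ℝ : E3 →L[ℝ] E3 →L[ℝ] ℝ)‖ ≤ 1 := norm_innerSL_le ℝ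
  have hterm : ∀ i ∈ Finset.range (j + 1),
      (j.choose i : ℝ) * ‖iteratedFDeriv ℝ i v y‖ * ‖iteratedFDeriv ℝ (j - i) v y‖ ≤
        (j ! : ℝ) * ρ⁻¹ ^ j * M ^ 2 * (lam v)⁻¹ ^ j := by
    intro i hi
    have hij : i ≤ j := Nat.lt_succ_iff.1 (Finset.mem_range.1 hi)
    have h1 := hAn i y
    have h2 := hAn (j - i) y
    have hchoose : (j.choose i : ℝ) * (i ! : ℝ) * ((j - i) ! : ℝ) = (j ! : ℝ) := by
      exact_mod_cast Nat.choose_mul_factorial_mul_factorial hij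
    calc (j.choose i : ℝ) * ‖iteratedFDeriv ℝ i v y‖ * ‖iteratedFDeriv ℝ (j - i) v y‖
        ≤ (j.choose i : ℝ) * ((i ! : ℝ) * ρ⁻¹ ^ i * M * (lam v)⁻¹ ^ i) *
            (((j - i) ! : ℝ) * ρ⁻¹ ^ (j - i) * M * (lam v)⁻¹ ^ (j - i)) :=
          mul_le_mul (mul_le_mul_of_nonneg_left h1 (by positivity)) h2 (norm_nonneg _) (by positivity)
      _ = ((j.choose i : ℝ) * (i ! : ℝ) * ((j - i) ! : ℝ)) * (ρ⁻¹ ^ i * ρ⁻¹ ^ (j - i)) * M ^ 2 *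
            ((lam v)⁻¹ ^ i * (lam v)⁻¹ ^ (j - i)) := by ring
      _ = (j ! : ℝ) * ρ⁻¹ ^ j * M ^ 2 * (lam v)⁻¹ ^ j := by
          rw [hchoose, ← pow_add, ← pow_add, Nat.add_sub_cancel' hij]
  calc ‖(innerSL ℝ : E3 →L[ℝ] E3 →L[ℝ] ℝ)‖ * ∑ i ∈ Finset.range (j + 1),
        (j.choose i : ℝ) * ‖iteratedFDeriv ℝ i v y‖ * ‖iteratedFDeriv ℝ (j - i) v y‖
      ≤ 1 * ∑ i ∈ Finset.range (j + 1), ((j ! : ℝ) * ρ⁻¹ ^ j * M ^ 2 * (lam v)⁻¹ ^ j) :=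
        mul_le_mul hB (Finset.sum_le_sum hterm) (Finset.sum_nonneg fun i _ => by positivity) zero_le_one
    _ = ((j : ℝ) + 1) * ((j ! : ℝ) * ρ⁻¹ ^ j * M ^ 2 * (lam v)⁻¹ ^ j) := by
        rw [one_mul, Finset.sum_const, Finset.card_range, nsmul_eq_mul]; push_cast; ring

/-- **P-R of LINE g8-β from P-F, PROVED** (`stub_analyticPlateauSpread`): the propagation-of-smallness fact for real-analytic functions
turns a fat near-top ball of a `ρ`-analytic-regular bounded field into near-maximal speed on any fixed multiple of the Taylor length.
[folklore] -/
theorem analyticPlateauSpread_of_propagation : AnalyticPropagationOfSmallness → AnalyticPlateauSpread := by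
  intro hPF ρ r c₀ R η hρ hr hc₀ hR hη
  -- the unit ball volume
  have hV₁pos : 0 < volume (Metric.ball (0 : E3) 1) := Metric.measure_ball_pos volume (0 : E3) one_pos
  have hV₁top : volume (Metric.ball (0 : E3) 1) < ⊤ := measure_ball_lt_top
  set w : ℝ := (volume (Metric.ball (0 : E3) 1)).toReal with hwdef
  have hw : 0 < w := ENNReal.toReal_pos hV₁pos.ne' hV₁top.ne
  -- radii, analyticity parameter and volume fraction for the fact
  set R₁ : ℝ := max R r with hR₁def
  have hR₁ : 0 < R₁ := lt_of_lt_of_le hR (le_max_left _ _)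
  have hRR₁ : R ≤ R₁ := le_max_left _ _
  have hrR₁ : r ≤ R₁ := le_max_right _ _
  set ρF : ℝ := min 1 (ρ / (2 * R₁)) with hρFdef
  have hρF : 0 < ρF := lt_min one_pos (by positivity)
  have hρF1 : ρF ≤ 1 := min_le_left _ _
  have hρFle : ρF ≤ ρ / (2 * R₁) := min_le_right _ _
  set s : ℝ := min 1 (c₀ * r ^ 3 / (R₁ ^ 3 * w)) with hsdef
  have hs : 0 < s := lt_min one_pos (by positivity)
  have hs1 : s ≤ 1 := min_le_left _ _
  have hsle : s ≤ c₀ * r ^ 3 / (R₁ ^ 3 * w) := min_le_right _ _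
  obtain ⟨Nc, θ, hNc, hθ, hθ1, hF⟩ := hPF ρF s hρF hρF1 hs hs1
  -- the near-top threshold `δ`
  set η' : ℝ := min η 1 with hη'def
  have hη' : 0 < η' := lt_min hη one_pos
  have hη'1 : η' ≤ 1 := min_le_right _ _
  have hη'η : η' ≤ η := min_le_left _ _
  set q : ℝ := (η' / Nc) ^ θ⁻¹ with hqdef
  have hq : 0 < q := Real.rpow_pos_of_pos (div_pos hη' hNc) _
  set δ : ℝ := min (1 / 2) (q / 2) with hδdef
  have hδ : 0 < δ := lt_min (by norm_num) (by positivity)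
  have hδhalf : δ ≤ 1 / 2 := min_le_left _ _
  have hδq : 2 * δ ≤ q := by have := min_le_right (1 / 2 : ℝ) (q / 2); rw [← hδdef] at this; linarith
  refine ⟨δ, hδ, fun v M x₀ hM hv hvM hAn hlam hfat x hx => ?_⟩
  set L : ℝ := lam v with hLdef
  set RF : ℝ := R₁ * L with hRFdef
  have hRF : 0 < RF := mul_pos hR₁ hlam
  have hM2 : 0 < M ^ 2 := by positivity
  -- ### the function `g = M² − ‖v‖²`
  set g : E3 → ℝ := fun y => M ^ 2 - ‖v y‖ ^ 2 with hgdef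
  have hnsq : ContDiff ℝ (⊤ : ℕ∞) fun y => ‖v y‖ ^ 2 := hv.norm_sq ℝ
  have hgcd : ContDiff ℝ (⊤ : ℕ∞) g := contDiff_const.sub hnsq
  have hg0 : ∀ y, 0 ≤ g y := fun y => by
    have h1 : ‖v y‖ ^ 2 ≤ M ^ 2 := pow_le_pow_left₀ (norm_nonneg _) (hvM y) 2
    simp only [hgdef]; linarith
  have hgM : ∀ y, g y ≤ M ^ 2 := fun y => by
    have : 0 ≤ ‖v y‖ ^ 2 := sq_nonneg _
    simp only [hgdef]; linarith
  -- derivative bounds of `g` in the fact's form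
  have hρFRF : ρF * RF ≤ ρ * L / 2 := by
    calc ρF * RF ≤ ρ / (2 * R₁) * (R₁ * L) := mul_le_mul_of_nonneg_right hρFle hRF.le
      _ = ρ * L / 2 := by field_simp
  have hDg : ∀ (j : ℕ) (y : E3), y ∈ Metric.ball x₀ (2 * RF) →
      ‖iteratedFDeriv ℝ j g y‖ ≤ M ^ 2 * (j ! : ℝ) / (ρF * RF) ^ j := by
    intro j y _
    rcases Nat.eq_zero_or_pos j with hj | hj
    · subst hj
      rw [norm_iteratedFDeriv_zero, Real.norm_of_nonneg (hg0 y)]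
      simpa using hgM y
    · -- `Dʲ g = − Dʲ ‖v‖²`
      have hsub : iteratedFDeriv ℝ j g y = iteratedFDeriv ℝ j (fun _ : E3 => M ^ 2) y - iteratedFDeriv ℝ j (fun y => ‖v y‖ ^ 2) y := by
        have h := iteratedFDeriv_sub_apply (i := j) (x := y) (f := fun _ : E3 => M ^ 2) (g := fun y => ‖v y‖ ^ 2)
          contDiffAt_const (hnsq.contDiffAt.of_le (by exact_mod_cast le_top))
        exact h
      rw [hsub, iteratedFDeriv_const_of_ne (Nat.pos_iff_ne_zero.1 hj), Pi.zero_apply, zero_sub, norm_neg]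
      have h1 := norm_iteratedFDeriv_normSq_le hv hM.le hρ hlam hAn j y
      -- `(j+1) j! ρ^{-j} M² L^{-j} ≤ M² j! / (ρL/2)^j ≤ M² j! / (ρF RF)^j`
      have hj2 : ((j : ℝ) + 1) ≤ 2 ^ j := by exact_mod_cast Nat.lt_two_pow_self
      have hρL : 0 < ρ * L / 2 := by positivity
      calc ‖iteratedFDeriv ℝ j (fun y => ‖v y‖ ^ 2) y‖ ≤ ((j : ℝ) + 1) * ((j ! : ℝ) * ρ⁻¹ ^ j * M ^ 2 * (lam v)⁻¹ ^ j) := h1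
        _ ≤ 2 ^ j * ((j ! : ℝ) * ρ⁻¹ ^ j * M ^ 2 * (lam v)⁻¹ ^ j) :=
            mul_le_mul_of_nonneg_right hj2 (by positivity)
        _ = M ^ 2 * (j ! : ℝ) / (ρ * L / 2) ^ j := by
            rw [hLdef, div_pow, mul_pow, inv_pow, inv_pow]
            field_simp
        _ ≤ M ^ 2 * (j ! : ℝ) / (ρF * RF) ^ j := by
            apply div_le_div_of_nonneg_left (by positivity) (pow_pos (mul_pos hρF hRF) j)
            exact pow_le_pow_left₀ (mul_pos hρF hRF).le hρFRF j
  -- ### the fat set `E`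
  set E : Set E3 := {y : E3 | y ∈ Metric.ball x₀ (r * L) ∧ (1 - δ) * M ≤ ‖v y‖} with hEdef
  have hEmeas : MeasurableSet E := by
    show MeasurableSet ({y : E3 | y ∈ Metric.ball x₀ (r * L)} ∩ {y : E3 | (1 - δ) * M ≤ ‖v y‖})
    exact Metric.isOpen_ball.measurableSet.inter (measurableSet_le measurable_const hv.continuous.norm.measurable)
  have hEsub : E ⊆ Metric.ball x₀ RF := fun y hy =>
    Metric.ball_subset_ball (mul_le_mul_of_nonneg_right hrR₁ hlam.le) hy.1
  have hEfin : volume E ≠ ⊤ := (measure_ball_lt_top.trans_le' (measure_mono hEsub)).ne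
  have hEvol : c₀ * (r * L) ^ 3 ≤ (volume E).toReal := (ENNReal.ofReal_le_iff_le_toReal hEfin).1 hfat
  have hEpos : 0 < (volume E).toReal := lt_of_lt_of_le (by positivity) hEvol
  have hfrac : s * (volume (Metric.ball x₀ RF)).toReal ≤ (volume E).toReal := by
    have hvol : (volume (Metric.ball x₀ RF)).toReal = RF ^ 3 * w := by
      rw [Measure.addHaar_ball volume x₀ hRF.le, finrank_euclideanSpace_fin, ENNReal.toReal_mul,
        ENNReal.toReal_ofReal (by positivity)]
    rw [hvol]
    calc s * (RF ^ 3 * w) ≤ c₀ * r ^ 3 / (R₁ ^ 3 * w) * (RF ^ 3 * w) := mul_le_mul_of_nonneg_right hsle (by positivity)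
      _ = c₀ * (r * L) ^ 3 := by rw [hRFdef]; field_simp
      _ ≤ (volume E).toReal := hEvol
  -- ### the fact on the ball `B(x₀, R₁λ)`
  have hPFv := hF g x₀ RF (M ^ 2) hRF hM2 hgcd hDg E hEmeas hEsub hfrac
  -- the average of `g` over `E` is `≤ 2δM²`
  have hgE : ∀ y ∈ E, |g y| ≤ 2 * δ * M ^ 2 := by
    intro y hy
    rw [abs_of_nonneg (hg0 y)]
    have h1 : (1 - δ) * M ≤ ‖v y‖ := hy.2
    have h0 : 0 ≤ (1 - δ) * M := mul_nonneg (by linarith) hM.le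
    have h2 : ((1 - δ) * M) ^ 2 ≤ ‖v y‖ ^ 2 := pow_le_pow_left₀ h0 h1 2
    simp only [hgdef]
    nlinarith [h2, sq_nonneg δ, hM2]
  have hint : IntegrableOn (fun y => |g y|) E volume := by
    have hc : Continuous fun y => |g y| := (continuous_const.sub (hv.continuous.norm.pow 2)).abs
    exact (hc.continuousOn.integrableOn_compact (isCompact_closedBall x₀ RF)).mono_set
      (hEsub.trans Metric.ball_subset_closedBall)
  have havg : (∫ y in E, |g y|) / (volume E).toReal ≤ 2 * δ * M ^ 2 := by
    rw [div_le_iff₀ hEpos]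
    have h := setIntegral_mono_on hint (integrableOn_const hEfin) hEmeas hgE
    rw [setIntegral_const, smul_eq_mul, Measure.real] at h
    linarith [h]
  have havg0 : 0 ≤ (∫ y in E, |g y|) / (volume E).toReal :=
    div_nonneg (setIntegral_nonneg hEmeas fun y _ => abs_nonneg _) hEpos.le
  -- ### at the point `x ∈ B(x₀, Rλ) ⊆ B(x₀, R₁λ)`
  have hxF : x ∈ Metric.ball x₀ RF := Metric.ball_subset_ball (mul_le_mul_of_nonneg_right hRR₁ hlam.le) hx
  have hgx : g x ≤ η' * M ^ 2 := by
    have h1 := hPFv x hxF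
    have h2 : ((∫ y in E, |g y|) / (volume E).toReal) ^ θ ≤ (2 * δ * M ^ 2) ^ θ :=
      Real.rpow_le_rpow havg0 havg hθ.le
    have h3 : (2 * δ * M ^ 2) ^ θ * (M ^ 2) ^ (1 - θ) = (2 * δ) ^ θ * M ^ 2 := by
      rw [Real.mul_rpow (by positivity) hM2.le, mul_assoc, ← Real.rpow_add hM2, add_sub_cancel, Real.rpow_one]
    have h4 : (2 * δ) ^ θ ≤ η' / Nc := by
      calc (2 * δ) ^ θ ≤ q ^ θ := Real.rpow_le_rpow (by positivity) hδq hθ.le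
        _ = η' / Nc := by rw [hqdef, Real.rpow_inv_rpow (div_pos hη' hNc).le hθ.ne']
    calc g x ≤ |g x| := le_abs_self _
      _ ≤ Nc * ((∫ y in E, |g y|) / (volume E).toReal) ^ θ * (M ^ 2) ^ (1 - θ) := h1
      _ ≤ Nc * (2 * δ * M ^ 2) ^ θ * (M ^ 2) ^ (1 - θ) := by
          gcongr
      _ = Nc * ((2 * δ) ^ θ * M ^ 2) := by rw [mul_assoc, h3]
      _ ≤ Nc * (η' / Nc * M ^ 2) := by gcongr
      _ = η' * M ^ 2 := by field_simp
  -- `‖v x‖² ≥ (1 − η') M²`, hence `‖v x‖ ≥ (1 − η) M`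
  have hvx : (1 - η') * M ^ 2 ≤ ‖v x‖ ^ 2 := by simp only [hgdef] at hgx; linarith
  rcases le_or_gt 1 η with hη1 | hη1
  · exact le_trans (mul_nonpos_of_nonpos_of_nonneg (by linarith) hM.le) (norm_nonneg _)
  · have hη'eq : η' = η := min_eq_left hη1.le
    rw [hη'eq] at hvx
    have h0 : 0 ≤ (1 - η) * M := mul_nonneg (by linarith) hM.le
    have h1 : ((1 - η) * M) ^ 2 ≤ ‖v x‖ ^ 2 := by
      have : ((1 - η) * M) ^ 2 ≤ (1 - η) * M ^ 2 := by nlinarith [hM2, hη.le, hη1]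
      exact this.trans hvx
    calc (1 - η) * M = Real.sqrt (((1 - η) * M) ^ 2) := (Real.sqrt_sq h0).symm
      _ ≤ Real.sqrt (‖v x‖ ^ 2) := Real.sqrt_le_sqrt h1
      _ = ‖v x‖ := Real.sqrt_sq (norm_nonneg _)

end Summit.NavierStokesRegularity.NavierStokesRegularity.Theorems.NearExtremalTransiencePerFlow.AnalyticGap

end
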